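import Summits.Ventures.GridStability.Lyapunov.WSCC9LossySlabRoa
import Summits.Ventures.GridStability.Lyapunov.ClassicalSwingForward
import HarnessLib

/-!
# GridStability/Lyapunov/WSCC9LossySlabWellPosed — #35 «G2.c-WSCC9-LOSSY-SLAB» lane V: the sentence
# about THE MOTION from every machine state in the certified set (`∃!` solution ∧ `lossy_slab_roa`)

Venture GRIDFUSION, seat gridfusion-lyap-1 (g5), queue item (B) = lead g5 RULINGS 4a (2): the lane-V
PACKAGING of the global flow (lyap-2 `Models/ClassicalSwingGlobal.lean` p518035: through every machine
state of every classical model exactly one solution on `univ`; lyap-1 `Lyapunov/ClassicalSwingForward`: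
uniqueness on `[0, ∞)`, forward solution = global solution). Answers ref-2 LEDGER-2 row 229 W1 («for
every GLOBAL solution» was a hypothesis; nit N116 «hypothesis-free except for the initial data»
overstated by that clause): now the initial data are the ONLY hypothesis.

* `lossy_slab_roa_of_state` — for every machine state `x₀ : (Fin 3 → ℝ) × (Fin 3 → ℝ)` of
  M′ = `WSCC9.postB_SPdamp.toModel` whose Lur'e state lies in the slab `|σ_k − δ*_k| < γ = 2·arctan(13/200)`
  with `cert.V ≤ c = 176462957398167/222684717500000000`: there is EXACTLY ONE solution of M′ on `ℝ`
  through `x₀`, and (every) such solution keeps slab ∧ level for all `t ≥ 0` and has Lur'e state `→ 0`;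
* `lossy_slab_roa_Ici` — the same conclusions for every solution on `[0, ∞)` only (one-sided
  derivative at `0`), which is the restriction of the global one;
* `lurie_roa_of_state` — the same packaging of model-1's conditional #24 sentence `WSCC9.lurie_roa`
  (conditional on a circle-criterion certificate `Λ`; the tree's #24 OBSTRUCTION says that class is
  empty — packaged only for uniformity of wording).

THREE COLUMNS. CERTIFIED (kernel): the sentences above for the MODEL M′ = WSCC9-postB-SPdamp-h12
(post-fault-B classical model, transfer conductances KEPT, printed damping `D/M = 1/10, 1/5, 3/10`) in
the directed Lur'e presentation `WSCC9.lurieSystem`, CLASS C′ = slab + Popov `WSCC9LossySlab.cert`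
(vertex route, sos-2 Λ `2541e15e`). VALIDATED: as `WSCC9LossySlabRoa.lean`. MODELLED: MV-2 + MV-P +
MV-SPD + MV-h12; «`∃!` solution» upgrades the MODELLED reading of the sentence from «a priori (for
every solution, if any)» to «the motion from `x₀`». No sentence of this file says a grid is stable.
-/

noncomputable section

open Real Set Filter
open scoped Topology
open Literature.MathematicalPhysics.PowerSystems
open Literature.MathematicalPhysics.PowerSystems.LyapunovFunctionFamily
open Summit.Ventures.GridStability.Models

namespace Summit.Ventures.GridStability.Lyapunov.WSCC9LossySlab

/-- **#35 LANE V — THE SENTENCE ABOUT THE MOTION (hypothesis = the initial machine state only).**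
MODEL M′ = `WSCC9.postB_SPdamp.toModel`; CLASS C′ = `WSCC9LossySlab.cert`. For every machine state
`x₀` whose Lur'e state `(ω | σ − σ*)` lies in the slab `|σ_k − δ*_k| < γ = 2·arctan(13/200)` (nine
directed channels) with `V ≤ c = 176462957398167/222684717500000000`: (i) there is EXACTLY ONE
solution of M′ on all of `ℝ` with `c 0 = x₀` (global Lipschitz flow, p518035); (ii) every such
solution keeps the slab and the level for all `t ≥ 0` and its Lur'e state tends to `0` — every speed
deviation `→ 0`, every relative rotor angle `δ_{a+1} − δ_0 →` its post-fault equilibrium value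
(`lossy_slab_roa`). No sentence here says a grid is stable.
[cite: Pai1981, §4.7.3 eqs. (4.115)–(4.117); VuTuritsyn2017, §4.3 Theorem 1; Teschl2012, Thm. 2.2 and Cor. 2.6] -/
theorem lossy_slab_roa_of_state (x₀ : ClassicalSwing.State 3)
    (h0 : WSCC9.postB_SPdamp.lurieState WSCC9.postB_SPdamp.angleOf x₀ ∈ WSCC9.lurieSystem.slab (fun _ => γ))
    (h0c : cert.V (WSCC9.postB_SPdamp.lurieState WSCC9.postB_SPdamp.angleOf x₀) ≤ ((cQ : ℚ) : ℝ)) :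
    (∃! c : ℝ → ClassicalSwing.State 3, c 0 = x₀ ∧ WSCC9.postB_SPdamp.toModel.IsSolutionOn c univ) ∧
      ∀ c : ℝ → ClassicalSwing.State 3, c 0 = x₀ → WSCC9.postB_SPdamp.toModel.IsSolutionOn c univ →
        (∀ t, 0 ≤ t →
            WSCC9.postB_SPdamp.lurieState WSCC9.postB_SPdamp.angleOf (c t) ∈
                WSCC9.lurieSystem.slab (fun _ => γ) ∧
              cert.V (WSCC9.postB_SPdamp.lurieState WSCC9.postB_SPdamp.angleOf (c t)) ≤ ((cQ : ℚ) : ℝ)) ∧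
          Tendsto (fun t => WSCC9.postB_SPdamp.lurieState WSCC9.postB_SPdamp.angleOf (c t)) atTop (𝓝 0) :=
  WSCC9.postB_SPdamp.toModel.existsUnique_and_forall
    (I := fun x => WSCC9.postB_SPdamp.lurieState WSCC9.postB_SPdamp.angleOf x ∈
        WSCC9.lurieSystem.slab (fun _ => γ) ∧
      cert.V (WSCC9.postB_SPdamp.lurieState WSCC9.postB_SPdamp.angleOf x) ≤ ((cQ : ℚ) : ℝ))
    (fun _ hc hI => lossy_slab_roa hc hI.1 hI.2) ⟨h0, h0c⟩

/-- **Lane V for FORWARD solutions**: the conclusions of `lossy_slab_roa` for every solution of M′ on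
`[0, ∞)` only (one-sided derivative at `t = 0`) from the certified set — it is the restriction of the
unique global solution (`ClassicalSwingForward`), so nothing was lost by quantifying over `univ`.
[cite: Pai1981, §4.7.3 eqs. (4.115)–(4.117); VuTuritsyn2017, §4.3 Theorem 1; Teschl2012, Cor. 2.6] -/
theorem lossy_slab_roa_Ici {c : ℝ → ClassicalSwing.State 3}
    (hc : WSCC9.postB_SPdamp.toModel.IsSolutionOn c (Ici 0))
    (h0 : WSCC9.postB_SPdamp.lurieState WSCC9.postB_SPdamp.angleOf (c 0) ∈ WSCC9.lurieSystem.slab (fun _ => γ))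
    (h0c : cert.V (WSCC9.postB_SPdamp.lurieState WSCC9.postB_SPdamp.angleOf (c 0)) ≤ ((cQ : ℚ) : ℝ)) :
    (∀ t, 0 ≤ t →
        WSCC9.postB_SPdamp.lurieState WSCC9.postB_SPdamp.angleOf (c t) ∈ WSCC9.lurieSystem.slab (fun _ => γ) ∧
          cert.V (WSCC9.postB_SPdamp.lurieState WSCC9.postB_SPdamp.angleOf (c t)) ≤ ((cQ : ℚ) : ℝ)) ∧
      Tendsto (fun t => WSCC9.postB_SPdamp.lurieState WSCC9.postB_SPdamp.angleOf (c t)) atTop (𝓝 0) := by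
  obtain ⟨Γ, hΓ0, hΓ, heq⟩ := hc.exists_univ_extension
  have key := lossy_slab_roa hΓ (by rw [hΓ0]; exact h0) (by rw [hΓ0]; exact h0c)
  refine ⟨fun t ht => ?_, ClassicalSwing.tendsto_congr_of_eqOn_Ici heq
    (fun x => WSCC9.postB_SPdamp.lurieState WSCC9.postB_SPdamp.angleOf x) key.2⟩
  rw [heq (mem_Ici.2 ht)]
  exact key.1 t ht

/-- **#24's conditional sentence, packaged the same way** (model-1 `WSCC9.lurie_roa`, conditional on a
circle-criterion certificate `Λ` of `WSCC9.lurieSystem`; the tree's #24 obstruction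
`WSCC9LurieObstruction` says no admissible `Λ` exists — stated for uniformity of wording only): from
every machine state in `Λ`'s well exactly one global solution, and every one keeps the well and has
Lur'e state `→ 0`. [cite: Pai1981, §4.7.3 eqs. (4.115)–(4.117); VuTuritsyn2017, §4.3 Theorem 1; Teschl2012, Thm. 2.2] -/
theorem lurie_roa_of_state (Λ : QuadraticCertificate WSCC9.lurieSystem)
    (hg : ∀ k, Λ.g < sectorGain
      (InternalNode.channelShift WSCC9.postB_SPdamp.toModel.θpol WSCC9.postB_SPdamp.angleOf k))
    {sk : Fin 3 × Fin 3 → ℝ} (hs0 : ∀ k, 0 < sk k)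
    (hs : ∀ k, (sk k • Λ.P - Matrix.vecMulVec (WSCC9.lurieSystem.C k) (WSCC9.lurieSystem.C k)).PosSemidef)
    {lev : ℝ}
    (hlev : ∀ k, lev < (π / 2 -
      |InternalNode.channelShift WSCC9.postB_SPdamp.toModel.θpol WSCC9.postB_SPdamp.angleOf k|) ^ 2 / sk k)
    (x₀ : ClassicalSwing.State 3)
    (h0 : WSCC9.postB_SPdamp.lurieState WSCC9.postB_SPdamp.angleOf x₀ ∈ WSCC9.lurieSystem.halfPolytope)
    (h0c : Λ.V (WSCC9.postB_SPdamp.lurieState WSCC9.postB_SPdamp.angleOf x₀) ≤ lev) :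
    (∃! c : ℝ → ClassicalSwing.State 3, c 0 = x₀ ∧ WSCC9.postB_SPdamp.toModel.IsSolutionOn c univ) ∧
      ∀ c : ℝ → ClassicalSwing.State 3, c 0 = x₀ → WSCC9.postB_SPdamp.toModel.IsSolutionOn c univ →
        (∀ t, 0 ≤ t →
            WSCC9.postB_SPdamp.lurieState WSCC9.postB_SPdamp.angleOf (c t) ∈ WSCC9.lurieSystem.halfPolytope ∧
              Λ.V (WSCC9.postB_SPdamp.lurieState WSCC9.postB_SPdamp.angleOf (c t)) ≤ lev) ∧
          Tendsto (fun t => WSCC9.postB_SPdamp.lurieState WSCC9.postB_SPdamp.angleOf (c t)) atTop (𝓝 0) :=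
  WSCC9.postB_SPdamp.toModel.existsUnique_and_forall
    (I := fun x => WSCC9.postB_SPdamp.lurieState WSCC9.postB_SPdamp.angleOf x ∈
        WSCC9.lurieSystem.halfPolytope ∧
      Λ.V (WSCC9.postB_SPdamp.lurieState WSCC9.postB_SPdamp.angleOf x) ≤ lev)
    (fun _ hc hI => WSCC9.lurie_roa Λ hg hs0 hs hlev hc hI.1 hI.2) ⟨h0, h0c⟩

end Summit.Ventures.GridStability.Lyapunov.WSCC9LossySlab

end
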